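import Literature.NumberTheory.Automorphic.IrreducibleClassesComap
import Literature.NumberTheory.Automorphic.SmoothCharacterOfCharacter
import HarnessLib

/-!
# `π ⊠ χ`: irreducible classes boxed with a smooth character of a second factor; the LATTICE REDUCTION
# `Subrepresentation ((ρ ∘ pr₁) ⊗ (χ ∘ pr₂)) ≃o Subrepresentation ρ` and CONSTITUENT TRANSPORT along `⊠ χ`

Topic `NumberTheory/Automorphic`; namespaces `Literature.NumberTheory.Automorphic.{SmoothIrrep, IrrClass}`.  Generic representation theory,
fully proved; definitions WITH BODY (`subrepresentationTwistCompFstOrderIso`, `SmoothIrrep.boxChar`, `IrrClass.boxChar`); no named fact, no `sorry`, no instance, no notation.  Cell `pub/hodgecm-mathlib`, crux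
H413, F0P3b desk brief H0 «LATTICE REDUCTION» of the (N-H-ii) road (line «CMCharIdentityTest», stub `stub_hPrincipalSeriesJH`, ED. 10): the principal
series of `H_v = U(Φ₂)_v × U(Φ₁)_v` is ★ `UnitaryGroup.cmPrincipalSeriesH L v χ₂ χ₁ := (i(χ₂) ∘ pr₁) ⊗ (χ₁ ∘ pr₂)` (`Automorphic/UnitaryGroupPrincipalSeriesH`),
on which `U(Φ₁)_v` acts by the SCALAR `χ₁`; so its stable subspaces, constituents and length-two labels ★ `HLengthTwoLabels` are those of
`i(χ₂) = cmPrincipalSeries L 2 v χ₂` on `U(Φ₂)_v ≅ U(1,1)`, decorated by `χ₁`.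

For groups `G, G₁` (one universe, as ★ `SmoothIrrep`∕`IrrClass`), `ρ` a representation of `G` on `V` and `χ : G₁ →* ℂˣ`, write
`ρ ⊠ χ := Representation.twist (ρ.comp (MonoidHom.fst G G₁)) (χ.comp (MonoidHom.snd G G₁))` (`(g, g₁) ↦ χ(g₁) • ρ(g)` on `V`; spelled out, no abbreviation):
* §1 `twist_comp_fst_apply` (`rfl`), `…_mk_one`, `…_one_mk`; a subspace is `ρ ⊠ χ`-stable iff `ρ`-stable (`forall_apply_mem_twist_comp_fst_iff`), whence
  **`subrepresentationTwistCompFstOrderIso ρ χ : Subrepresentation (ρ ⊠ χ) ≃o Subrepresentation ρ`**, the identity on submodules (`…_apply_toSubmodule`,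
  `…_symm_apply_toSubmodule`, `rfl`); `ρ ⊠ χ` irreducible iff `ρ` is; the subquotient representations correspond, `(N₁ ⁄ N₂)(ρ ⊠ χ)(g, g₁) = χ g₁ • (N₁ ⁄ N₂)(ρ) g`
  (`subquotient_twist_comp_fst_eq`, `…_eq'`, definitional on representatives).
* §2 **`SmoothIrrep.boxChar r χ hχ`** (`ker χ` open; irreducible by §1, smooth by ★ `IsSmooth.comp` + ★ `IsSmooth.twist`), **`IrrClass.boxChar χ hχ :
  Irr(G) → Irr(G × G₁)`**, `⟦r⟧ ↦ ⟦r ⊠ χ⟧` (`boxChar_mk`, `rfl`), INJECTIVE (`boxChar_injective`: restrict an isomorphism to `G × 1`).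
* §3 CONSTITUENT TRANSPORT: `(c ⊠ χ).IsConstituentOf (ρ ⊠ χ) ↔ c.IsConstituentOf ρ` (`boxChar_isConstituentOf_iff`); EVERY constituent of `ρ ⊠ χ` is a box
  (`exists_eq_boxChar_of_isConstituentOf`: on an irreducible subquotient `1 × G₁` acts by `χ`, so its restriction to `G × 1` is irreducible smooth and boxes
  back to it); `isConstituentOf_twist_comp_fst_iff`; the length-two LABEL transport in the shape of ★ `KeysCaseTwoLabels`∕`HLengthTwoLabels` both ways
  (`constituents_pair_boxChar`, `exists_constituents_pair_of_boxChar`).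
* §4 `boxChar χ hχ ⟦ℂ_ξ⟧ = ⟦ℂ_Ξ⟧` for `Ξ(g, g₁) = ξ(g) χ(g₁)` (★ `SmoothIrrep.ofChar`, p841475): the consumer's one-dimensional label `π₁ = ⟦ξ_v⟧` is the box of
  the one-dimensional constituent of `i(χ₂)` (`boxChar_mk_ofChar`).
* THE CM INSTANCE (`cmPrincipalSeriesH L v χ₂ χ₁ = i(χ₂) ⊠ χ₁`, its order isomorphism and `HLengthTwoLabels` transport) is the sequel
  `Automorphic/UnitaryGroupPrincipalSeriesHLattice`.
Standard ([BushnellHenniart2006, §1.1–§2, §9.1]; [Rogawski1990, §12.1 p. 171: `i_H(χ)` for `H = U(2) × U(1)`]).  HONEST LABEL: HC_CM is proved only modulo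
the 2 remaining named inputs (hLiu418, h413) until rung 0 closes; this file is representation-theoretic plumbing and discharges none of them.

## References
[BushnellHenniart2006] C. J. Bushnell, G. Henniart, *The Local Langlands Conjecture for GL(2)*, Grundlehren 335 (2006), §1.1–§2, §9.1 ·
[Rogawski1990] J. D. Rogawski, *Automorphic Representations of Unitary Groups in Three Variables*, Ann. of Math. Stud. 123 (1990), §12.1 pp. 171–172.
-/

set_option autoImplicit false

noncomputable section

namespace Literature.NumberTheory.Automorphic

universe u

/-! ## §1 The representation `ρ ⊠ χ = (ρ ∘ pr₁) ⊗ (χ ∘ pr₂)` of `G × G₁`: operators, stable subspaces, subquotients -/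

section BoxTwist

variable {G G₁ : Type u} [Group G] [Group G₁] {V : Type*} [AddCommGroup V] [Module ℂ V]
  (ρ : Representation ℂ G V) (χ : G₁ →* ℂˣ)

/-- `(ρ ⊠ χ)(g, g₁) v = χ(g₁) • ρ(g) v` (definitional). [cite: BushnellHenniart2006, §9.1] -/
theorem twist_comp_fst_apply (g : G × G₁) (v : V) :
    Representation.twist (ρ.comp (MonoidHom.fst G G₁)) (χ.comp (MonoidHom.snd G G₁)) g v = ((χ g.2 : ℂˣ) : ℂ) • ρ g.1 v :=
  rfl

/-- On the first factor `ρ ⊠ χ` is `ρ`: `(ρ ⊠ χ)(g, 1) v = ρ g v`. [cite: BushnellHenniart2006, §9.1] -/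
theorem twist_comp_fst_apply_mk_one (g : G) (v : V) :
    Representation.twist (ρ.comp (MonoidHom.fst G G₁)) (χ.comp (MonoidHom.snd G G₁)) (g, 1) v = ρ g v := by
  rw [twist_comp_fst_apply, map_one, Units.val_one, one_smul]

/-- On the second factor `ρ ⊠ χ` is the scalar `χ`: `(ρ ⊠ χ)(1, g₁) v = χ(g₁) • v`. [cite: BushnellHenniart2006, §9.1] -/
theorem twist_comp_fst_apply_one_mk (g₁ : G₁) (v : V) :
    Representation.twist (ρ.comp (MonoidHom.fst G G₁)) (χ.comp (MonoidHom.snd G G₁)) (1, g₁) v = ((χ g₁ : ℂˣ) : ℂ) • v := by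
  rw [twist_comp_fst_apply, map_one, Module.End.one_apply]

/-- **A subspace is `ρ ⊠ χ`-stable iff it is `ρ`-stable** (`χ(g₁)` is a unit scalar; `(g, 1) ↦ ρ g`). [cite: BushnellHenniart2006, §9.1] -/
theorem forall_apply_mem_twist_comp_fst_iff (N : Submodule ℂ V) :
    (∀ (g : G × G₁) ⦃v : V⦄, v ∈ N → Representation.twist (ρ.comp (MonoidHom.fst G G₁)) (χ.comp (MonoidHom.snd G G₁)) g v ∈ N) ↔
      ∀ (g : G) ⦃v : V⦄, v ∈ N → ρ g v ∈ N := by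
  refine ⟨fun h g v hv => ?_, fun h g v hv => ?_⟩
  · rw [← twist_comp_fst_apply_mk_one ρ χ g v]
    exact h (g, 1) hv
  · rw [twist_comp_fst_apply]
    exact N.smul_mem _ (h g.1 hv)

/-- **LATTICE REDUCTION `Subrepresentation (ρ ⊠ χ) ≃o Subrepresentation ρ`** — the identity on underlying submodules: the
`G × G₁`-stable subspaces of `(ρ ∘ pr₁) ⊗ (χ ∘ pr₂)` are exactly the `G`-stable subspaces of `ρ`. [cite: BushnellHenniart2006, §9.1] -/
def subrepresentationTwistCompFstOrderIso :
    Subrepresentation (Representation.twist (ρ.comp (MonoidHom.fst G G₁)) (χ.comp (MonoidHom.snd G G₁))) ≃o Subrepresentation ρ where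
  toFun N' := ⟨N'.toSubmodule, (forall_apply_mem_twist_comp_fst_iff ρ χ N'.toSubmodule).1 N'.apply_mem_toSubmodule⟩
  invFun N := ⟨N.toSubmodule, (forall_apply_mem_twist_comp_fst_iff ρ χ N.toSubmodule).2 N.apply_mem_toSubmodule⟩
  left_inv _ := rfl
  right_inv _ := rfl
  map_rel_iff' := Iff.rfl

/-- The order isomorphism does not move the submodule. [cite: BushnellHenniart2006, §9.1] -/
@[simp] theorem subrepresentationTwistCompFstOrderIso_apply_toSubmodule
    (N' : Subrepresentation (Representation.twist (ρ.comp (MonoidHom.fst G G₁)) (χ.comp (MonoidHom.snd G G₁)))) :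
    (subrepresentationTwistCompFstOrderIso ρ χ N').toSubmodule = N'.toSubmodule := rfl

/-- Nor does its inverse. [cite: BushnellHenniart2006, §9.1] -/
@[simp] theorem subrepresentationTwistCompFstOrderIso_symm_apply_toSubmodule (N : Subrepresentation ρ) :
    ((subrepresentationTwistCompFstOrderIso ρ χ).symm N).toSubmodule = N.toSubmodule := rfl

/-- `ρ ⊠ χ` is irreducible iff `ρ` is. [cite: BushnellHenniart2006, §9.1] -/
theorem isIrreducible_twist_comp_fst_iff :
    (Representation.twist (ρ.comp (MonoidHom.fst G G₁)) (χ.comp (MonoidHom.snd G G₁))).IsIrreducible ↔ ρ.IsIrreducible :=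
  (subrepresentationTwistCompFstOrderIso ρ χ).isSimpleOrder_iff

/-- **Subquotients correspond**: on the common quotient space `N₁ ⁄ N₂` (`N₂ ≤ N₁` stable), the subquotient representation of
`ρ ⊠ χ` at `(g, g₁)` is `χ(g₁) •` the subquotient representation of `ρ` at `g` (definitional on representatives). [cite: BushnellHenniart2006, §2] -/
theorem subquotient_twist_comp_fst_eq (N₁ N₂ : Subrepresentation ρ) (g : G × G₁) :
    (((subrepresentationTwistCompFstOrderIso ρ χ).symm N₁).toRepresentation.quotient
        (((subrepresentationTwistCompFstOrderIso ρ χ).symm N₂).toSubmodule.comap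
          ((subrepresentationTwistCompFstOrderIso ρ χ).symm N₁).toSubmodule.subtype)
        fun g' _ hx ↦ ((subrepresentationTwistCompFstOrderIso ρ χ).symm N₂).apply_mem_toSubmodule g' hx) g =
      ((χ g.2 : ℂˣ) : ℂ) •
        (N₁.toRepresentation.quotient (N₂.toSubmodule.comap N₁.toSubmodule.subtype)
          fun g' _ hx ↦ N₂.apply_mem_toSubmodule g' hx) g.1 := by
  refine LinearMap.ext fun x => ?_
  obtain ⟨x, rfl⟩ := Submodule.Quotient.mk_surjective _ x
  rfl

/-- The same correspondence read from a pair of `ρ ⊠ χ`-stable subspaces `N₂′ ≤ N₁′`. [cite: BushnellHenniart2006, §2] -/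
theorem subquotient_twist_comp_fst_eq'
    (N₁' N₂' : Subrepresentation (Representation.twist (ρ.comp (MonoidHom.fst G G₁)) (χ.comp (MonoidHom.snd G G₁)))) (g : G × G₁) :
    (N₁'.toRepresentation.quotient (N₂'.toSubmodule.comap N₁'.toSubmodule.subtype)
        fun g' _ hx ↦ N₂'.apply_mem_toSubmodule g' hx) g =
      ((χ g.2 : ℂˣ) : ℂ) •
        ((subrepresentationTwistCompFstOrderIso ρ χ N₁').toRepresentation.quotient
          ((subrepresentationTwistCompFstOrderIso ρ χ N₂').toSubmodule.comap
            (subrepresentationTwistCompFstOrderIso ρ χ N₁').toSubmodule.subtype)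
          fun g' _ hx ↦ (subrepresentationTwistCompFstOrderIso ρ χ N₂').apply_mem_toSubmodule g' hx) g.1 := by
  refine LinearMap.ext fun x => ?_
  obtain ⟨x, rfl⟩ := Submodule.Quotient.mk_surjective _ x
  rfl

end BoxTwist

/-! ## §2 `boxChar` on `SmoothIrrep` and on `IrrClass` -/

section Topological

variable {G G₁ : Type u} [Group G] [TopologicalSpace G] [Group G₁] [TopologicalSpace G₁]

/-- The kernel of `χ ∘ pr₂` is open when `ker χ` is (so `χ ∘ pr₂` is a smooth character of `G × G₁`). [cite: BushnellHenniart2006, §1.1] -/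
theorem isOpen_ker_comp_snd (χ : G₁ →* ℂˣ) (hχ : IsOpen ((χ.ker : Subgroup G₁) : Set G₁)) :
    IsOpen (((χ.comp (MonoidHom.snd G G₁)).ker : Subgroup (G × G₁)) : Set (G × G₁)) := by
  rw [← MonoidHom.comap_ker, Subgroup.coe_comap]
  exact hχ.preimage continuous_snd

variable [ContinuousMul G] [ContinuousMul G₁]

namespace SmoothIrrep

variable (r : SmoothIrrep G) (χ : G₁ →* ℂˣ) (hχ : IsOpen ((χ.ker : Subgroup G₁) : Set G₁))

/-- **`r ⊠ χ` — the external product of an irreducible smooth representation `r` of `G` with a smooth character `χ` of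
`G₁`** (`ker χ` open): the space `r.V` with the action `(g, g₁) ↦ χ(g₁) • r.ρ(g)` of `G × G₁`; irreducible (same stable
subspaces as `r`, §1) and smooth (`Stab(v) ⊇ Stab_r(v) × ker χ`).  For `H = U(2) × U(1)` these are the irreducibles of `H`
with `U(1)` acting by `χ`. [cite: BushnellHenniart2006, §9.1] [cite: Rogawski1990, §12.1 p. 171] -/
def boxChar : SmoothIrrep (G × G₁) where
  V := r.V
  ρ := Representation.twist (r.ρ.comp (MonoidHom.fst G G₁)) (χ.comp (MonoidHom.snd G G₁))
  isIrreducible := (isIrreducible_twist_comp_fst_iff r.ρ χ).2 r.isIrreducible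
  isSmooth := (r.isSmooth.comp (MonoidHom.fst G G₁) continuous_fst).twist (isOpen_ker_comp_snd χ hχ)

/-- The action of `r ⊠ χ` is `(r.ρ ∘ pr₁) ⊗ (χ ∘ pr₂)`. [cite: BushnellHenniart2006, §9.1] -/
theorem boxChar_ρ :
    (r.boxChar χ hχ).ρ = Representation.twist (r.ρ.comp (MonoidHom.fst G G₁)) (χ.comp (MonoidHom.snd G G₁)) := rfl

/-- `(r ⊠ χ)(g, g₁) v = χ(g₁) • r(g) v`. [cite: BushnellHenniart2006, §9.1] -/
theorem boxChar_ρ_apply (g : G × G₁) (v : r.V) :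
    (r.boxChar χ hχ).ρ g v = ((χ g.2 : ℂˣ) : ℂ) • r.ρ g.1 v := rfl

/-- `(r ⊠ χ)(g, 1) v = r(g) v`. [cite: BushnellHenniart2006, §9.1] -/
theorem boxChar_ρ_apply_mk_one (g : G) (v : r.V) :
    (r.boxChar χ hχ).ρ (g, 1) v = r.ρ g v :=
  twist_comp_fst_apply_mk_one r.ρ χ g v

variable {r} in
/-- **`⊠ χ` respects isomorphism** (the same linear isomorphism intertwines): well-definedness of `IrrClass.boxChar`. [cite: BushnellHenniart2006, §9.1] -/
theorem boxChar_equiv {r₁ r₂ : SmoothIrrep G} (h : r₁ ≈ r₂) :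
    r₁.boxChar χ hχ ≈ r₂.boxChar χ hχ := by
  obtain ⟨φ⟩ := (SmoothIrrep.equiv_iff r₁ r₂).1 h
  refine (SmoothIrrep.equiv_iff _ _).2 ⟨Representation.Equiv.mk φ.toLinearEquiv fun g => ?_⟩
  change φ.toLinearMap ∘ₗ (((χ g.2 : ℂˣ) : ℂ) • r₁.ρ g.1) = (((χ g.2 : ℂˣ) : ℂ) • r₂.ρ g.1) ∘ₗ φ.toLinearMap
  rw [LinearMap.comp_smul, LinearMap.smul_comp, φ.isIntertwining' g.1]

end SmoothIrrep

namespace IrrClass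

variable (χ : G₁ →* ℂˣ) (hχ : IsOpen ((χ.ker : Subgroup G₁) : Set G₁))

/-- **`Irr(G) → Irr(G × G₁)`, `⟦r⟧ ↦ ⟦r ⊠ χ⟧`** for a smooth character `χ` of `G₁` (well defined by `SmoothIrrep.boxChar_equiv`).
[cite: BushnellHenniart2006, §9.1] [cite: Rogawski1990, §12.1 p. 171] -/
def boxChar : IrrClass G → IrrClass (G × G₁) :=
  Quotient.map (fun r => r.boxChar χ hχ) fun _ _ h => SmoothIrrep.boxChar_equiv χ hχ h

/-- Computation rule on a class `⟦r⟧`. [cite: BushnellHenniart2006, §9.1] -/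
@[simp] theorem boxChar_mk (r : SmoothIrrep G) :
    boxChar χ hχ (IrrClass.mk r) = IrrClass.mk (r.boxChar χ hχ) := rfl

/-- **`⊠ χ` is injective on classes**: an isomorphism `r₁ ⊠ χ ≅ r₂ ⊠ χ` of representations of `G × G₁` is, restricted to
`G × 1`, an isomorphism `r₁ ≅ r₂`. [cite: BushnellHenniart2006, §9.1] -/
theorem boxChar_injective : Function.Injective (boxChar χ hχ : IrrClass G → IrrClass (G × G₁)) := by
  intro c₁ c₂ h
  obtain ⟨r₁, rfl⟩ := IrrClass.mk_surjective c₁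
  obtain ⟨r₂, rfl⟩ := IrrClass.mk_surjective c₂
  rw [boxChar_mk, boxChar_mk, IrrClass.mk_eq_mk_iff] at h
  obtain ⟨φ⟩ := h
  refine IrrClass.mk_eq_mk_of_equiv (Representation.Equiv.mk φ.toLinearEquiv fun g => ?_)
  have h1 := φ.isIntertwining' (g, 1)
  have e₁ : (r₁.boxChar χ hχ).ρ (g, 1) = r₁.ρ g := LinearMap.ext (SmoothIrrep.boxChar_ρ_apply_mk_one r₁ χ hχ g)
  have e₂ : (r₂.boxChar χ hχ).ρ (g, 1) = r₂.ρ g := LinearMap.ext (SmoothIrrep.boxChar_ρ_apply_mk_one r₂ χ hχ g)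
  rw [e₁, e₂] at h1
  exact h1

/-! ## §3 Constituent transport along `⊠ χ` -/

variable {V : Type*} [AddCommGroup V] [Module ℂ V]

/-- **(⇐) Constituents box**: if `c` is a constituent of `ρ` (`r ≅ N₁ ⁄ N₂`) then `c ⊠ χ` is a constituent of `ρ ⊠ χ` — the same
`N₂ ≤ N₁` are `ρ ⊠ χ`-stable and the same linear isomorphism intertwines `r ⊠ χ` with the subquotient (§1
`subquotient_twist_comp_fst_eq`). [cite: Rogawski1990, §12.1 p. 171] [cite: BushnellHenniart2006, §2] -/
theorem IsConstituentOf.boxChar {ρ : Representation ℂ G V} {c : IrrClass G} (h : c.IsConstituentOf ρ) :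
    (boxChar χ hχ c).IsConstituentOf (Representation.twist (ρ.comp (MonoidHom.fst G G₁)) (χ.comp (MonoidHom.snd G G₁))) := by
  obtain ⟨r, rfl, N₁, N₂, hle, ⟨φ⟩⟩ := h
  refine ⟨r.boxChar χ hχ, rfl, (subrepresentationTwistCompFstOrderIso ρ χ).symm N₁,
    (subrepresentationTwistCompFstOrderIso ρ χ).symm N₂, fun v hv => hle hv, ⟨Representation.Equiv.mk φ.toLinearEquiv fun g => ?_⟩⟩
  rw [subquotient_twist_comp_fst_eq ρ χ N₁ N₂ g]
  refine LinearMap.ext fun v => ?_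
  exact (φ.toLinearEquiv.map_smul ((χ g.2 : ℂˣ) : ℂ) (r.ρ g.1 v)).trans
    (congrArg (((χ g.2 : ℂˣ) : ℂ) • ·) (φ.toIntertwiningMap.isIntertwining r.ρ _ g.1 v))

/-- **Every constituent of `ρ ⊠ χ` is a box `c ⊠ χ` with `c` a constituent of `ρ`**: on an irreducible subquotient `r′ ≅ N₁ ⁄ N₂`
of `ρ ⊠ χ` the factor `1 × G₁` acts by the scalar `χ` (it does so on `N₁ ⁄ N₂`), so `r′(g, g₁) = χ(g₁) • r′(g, 1)`, the restriction
`r := r′|_{G × 1}` is irreducible and smooth, `r ⊠ χ ≅ r′` by the identity, and `r ≅ N₁ ⁄ N₂` as a subquotient of `ρ`.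
[cite: Rogawski1990, §12.1 p. 171] [cite: BushnellHenniart2006, §2] -/
theorem exists_eq_boxChar_of_isConstituentOf {ρ : Representation ℂ G V} {c' : IrrClass (G × G₁)}
    (h : c'.IsConstituentOf (Representation.twist (ρ.comp (MonoidHom.fst G G₁)) (χ.comp (MonoidHom.snd G G₁)))) :
    ∃ c : IrrClass G, c' = boxChar χ hχ c ∧ c.IsConstituentOf ρ := by
  obtain ⟨r', rfl, N₁', N₂', hle, ⟨φ⟩⟩ := h
  -- `1 × G₁` acts on `r'` by the scalar `χ` (it does so on the subquotient `N₁' ⁄ N₂'`)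
  have hsc : ∀ (g₁ : G₁) (v : r'.V), r'.ρ (1, g₁) v = ((χ g₁ : ℂˣ) : ℂ) • v := by
    intro g₁ v
    apply φ.toLinearEquiv.injective
    have h1 := φ.isIntertwining' (1, g₁)
    rw [subquotient_twist_comp_fst_eq' ρ χ N₁' N₂' (1, g₁), map_one] at h1
    have h2 := congr($h1 v)
    simp only [LinearMap.comp_apply] at h2
    rw [LinearEquiv.map_smul]
    exact h2
  have hdec : ∀ (g : G × G₁) (v : r'.V), r'.ρ g v = ((χ g.2 : ℂˣ) : ℂ) • r'.ρ (g.1, 1) v := by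
    intro g v
    conv_lhs => rw [← Prod.fst_mul_snd g, map_mul, Module.End.mul_apply, hsc, map_smul]
  -- the restriction of `r'` to `G × 1`
  let r : SmoothIrrep G :=
    { V := r'.V
      ρ := r'.ρ.comp (MonoidHom.inl G G₁)
      isIrreducible :=
        (Representation.isIrreducible_iff_of_twist_equivariant r'.ρ (r'.ρ.comp (MonoidHom.inl G G₁)) (MonoidHom.fst G G₁)
          Prod.fst_surjective (LinearEquiv.refl ℂ r'.V) (fun g => χ g.2) fun g v => hdec g v).1 r'.isIrreducible
      isSmooth := r'.isSmooth.comp (MonoidHom.inl G G₁) (continuous_id.prodMk continuous_const) }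
  have hr : ∀ (g : G) (v : r'.V), r.ρ g v = r'.ρ (g, 1) v := fun _ _ => rfl
  refine ⟨IrrClass.mk r, ?_, ?_⟩
  · -- `r ⊠ χ ≅ r'` by the identity
    rw [boxChar_mk]
    refine (IrrClass.mk_eq_mk_of_equiv
      (Representation.Equiv.mk (ρ := (r.boxChar χ hχ).ρ) (σ := r'.ρ) (LinearEquiv.refl ℂ r'.V) fun g => ?_)).symm
    refine LinearMap.ext fun v => ?_
    change (r.boxChar χ hχ).ρ g v = r'.ρ g v
    rw [SmoothIrrep.boxChar_ρ_apply, hr, hdec g v]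
  · -- `r ≅ N₁' ⁄ N₂'` as a subquotient of `ρ`
    refine ⟨r, rfl, subrepresentationTwistCompFstOrderIso ρ χ N₁', subrepresentationTwistCompFstOrderIso ρ χ N₂',
      fun v hv => hle hv, ⟨Representation.Equiv.mk φ.toLinearEquiv fun g => ?_⟩⟩
    have h1 := φ.isIntertwining' (g, 1)
    have hq := subquotient_twist_comp_fst_eq' ρ χ N₁' N₂' (g, 1)
    rw [map_one, Units.val_one, one_smul] at hq
    rw [hq] at h1
    exact h1

/-- **CONSTITUENT TRANSPORT along `⊠ χ`**: `c ⊠ χ` is a constituent of `ρ ⊠ χ` iff `c` is a constituent of `ρ`.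
[cite: Rogawski1990, §12.1 p. 171] [cite: BushnellHenniart2006, §2] -/
theorem boxChar_isConstituentOf_iff (ρ : Representation ℂ G V) (c : IrrClass G) :
    (boxChar χ hχ c).IsConstituentOf (Representation.twist (ρ.comp (MonoidHom.fst G G₁)) (χ.comp (MonoidHom.snd G G₁))) ↔
      c.IsConstituentOf ρ := by
  refine ⟨fun h => ?_, fun h => h.boxChar χ hχ⟩
  obtain ⟨c₀, hc₀, h₀⟩ := exists_eq_boxChar_of_isConstituentOf χ hχ h
  rwa [boxChar_injective χ hχ hc₀]

/-- **The constituents of `ρ ⊠ χ` are exactly the boxes of the constituents of `ρ`.** [cite: Rogawski1990, §12.1 p. 171] [cite: BushnellHenniart2006, §2] -/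
theorem isConstituentOf_twist_comp_fst_iff (ρ : Representation ℂ G V) (c' : IrrClass (G × G₁)) :
    c'.IsConstituentOf (Representation.twist (ρ.comp (MonoidHom.fst G G₁)) (χ.comp (MonoidHom.snd G G₁))) ↔
      ∃ c : IrrClass G, c' = boxChar χ hχ c ∧ c.IsConstituentOf ρ := by
  refine ⟨exists_eq_boxChar_of_isConstituentOf χ hχ, ?_⟩
  rintro ⟨c, rfl, hc⟩
  exact hc.boxChar χ hχ

/-- **LABEL TRANSPORT (⇒)**: if the constituents of `ρ` are exactly `{π₁, πSt}` with `πSt ≠ π₁` (the shape of ★ `KeysCaseTwoLabels` ∕ ★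
`HLengthTwoLabels`), then the constituents of `ρ ⊠ χ` are exactly `{π₁ ⊠ χ, πSt ⊠ χ}` with `πSt ⊠ χ ≠ π₁ ⊠ χ`. [cite: Rogawski1990, §12.1 pp. 171–172] -/
theorem constituents_pair_boxChar {ρ : Representation ℂ G V} {π₁ πSt : IrrClass G} (hne : πSt ≠ π₁)
    (h : ∀ c : IrrClass G, c.IsConstituentOf ρ ↔ (c = π₁ ∨ c = πSt)) :
    boxChar χ hχ πSt ≠ boxChar χ hχ π₁ ∧
      ∀ c' : IrrClass (G × G₁),
        c'.IsConstituentOf (Representation.twist (ρ.comp (MonoidHom.fst G G₁)) (χ.comp (MonoidHom.snd G G₁))) ↔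
          (c' = boxChar χ hχ π₁ ∨ c' = boxChar χ hχ πSt) := by
  refine ⟨fun e => hne (boxChar_injective χ hχ e), fun c' => ?_⟩
  rw [isConstituentOf_twist_comp_fst_iff χ hχ]
  constructor
  · rintro ⟨c, rfl, hc⟩
    rcases (h c).1 hc with rfl | rfl
    · exact Or.inl rfl
    · exact Or.inr rfl
  · rintro (rfl | rfl)
    · exact ⟨π₁, rfl, (h π₁).2 (Or.inl rfl)⟩
    · exact ⟨πSt, rfl, (h πSt).2 (Or.inr rfl)⟩

/-- **LABEL TRANSPORT (⇐)**: if the constituents of `ρ ⊠ χ` are exactly `{π₁′, πSt′}` with `πSt′ ≠ π₁′`, then `π₁′ = π₁ ⊠ χ`, `πSt′ = πSt ⊠ χ`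
for (unique) classes `π₁ ≠ πSt` of `G` which are exactly the constituents of `ρ`. [cite: Rogawski1990, §12.1 pp. 171–172] -/
theorem exists_constituents_pair_of_boxChar {ρ : Representation ℂ G V} {π₁' πSt' : IrrClass (G × G₁)} (hne : πSt' ≠ π₁')
    (h : ∀ c' : IrrClass (G × G₁),
      c'.IsConstituentOf (Representation.twist (ρ.comp (MonoidHom.fst G G₁)) (χ.comp (MonoidHom.snd G G₁))) ↔ (c' = π₁' ∨ c' = πSt')) :
    ∃ π₁ πSt : IrrClass G, π₁' = boxChar χ hχ π₁ ∧ πSt' = boxChar χ hχ πSt ∧ πSt ≠ π₁ ∧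
      ∀ c : IrrClass G, c.IsConstituentOf ρ ↔ (c = π₁ ∨ c = πSt) := by
  obtain ⟨π₁, rfl, h₁⟩ := exists_eq_boxChar_of_isConstituentOf χ hχ ((h π₁').2 (Or.inl rfl))
  obtain ⟨πSt, rfl, hSt⟩ := exists_eq_boxChar_of_isConstituentOf χ hχ ((h πSt').2 (Or.inr rfl))
  refine ⟨π₁, πSt, rfl, rfl, fun e => hne (congrArg _ e), fun c => ?_⟩
  rw [← boxChar_isConstituentOf_iff χ hχ ρ c, h]
  constructor
  · rintro (e | e)
    · exact Or.inl (boxChar_injective χ hχ e)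
    · exact Or.inr (boxChar_injective χ hχ e)
  · rintro (rfl | rfl)
    · exact Or.inl rfl
    · exact Or.inr rfl

end IrrClass

end Topological

/-! ## §4 The box of a one-dimensional class is one-dimensional: `⟦ℂ_ξ⟧ ⊠ χ = ⟦ℂ_{(ξ ∘ pr₁)(χ ∘ pr₂)}⟧` -/

namespace IrrClass

variable {G G₁ : Type u} [Group G] [TopologicalSpace G] [IsTopologicalGroup G] [Group G₁] [TopologicalSpace G₁] [IsTopologicalGroup G₁]

/-- **`⟦ℂ_ξ⟧ ⊠ χ = ⟦ℂ_Ξ⟧` for any character `Ξ` of `G × G₁` with `Ξ(g, g₁) = ξ(g) χ(g₁)`** (★ `SmoothIrrep.ofChar`; the identity of `ℂ`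
intertwines: both act on `ℂ` by `χ(g₁) ξ(g)`).  For `H = U(2) × U(1)` and `Ξ = ξ_v = (η′ ∘ det₀)(χ₂ ∘ det)`: the consumer's label
`π₁ = ⟦ξ_v⟧` is the box of the one-dimensional constituent `⟦(η′ ∘ det₀)·(χ₂ ∘ det)|_{U(2)}⟧` of `i(χ₂)` with the character `χ₂ ∘ det` of `U(1)`.
[cite: Rogawski1990, §12.1 p. 171] -/
theorem boxChar_mk_ofChar (ξ : G →* ℂˣ) (hξ : IsOpen ((ξ.ker : Subgroup G) : Set G)) (χ : G₁ →* ℂˣ)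
    (hχ : IsOpen ((χ.ker : Subgroup G₁) : Set G₁)) (Ξ : G × G₁ →* ℂˣ) (hΞ : IsOpen ((Ξ.ker : Subgroup (G × G₁)) : Set (G × G₁)))
    (hΞξχ : ∀ g : G × G₁, Ξ g = ξ g.1 * χ g.2) :
    boxChar χ hχ (IrrClass.mk (SmoothIrrep.ofChar ξ hξ)) = IrrClass.mk (SmoothIrrep.ofChar Ξ hΞ) := by
  rw [boxChar_mk]
  refine IrrClass.mk_eq_mk_of_equiv (Representation.Equiv.mk (LinearEquiv.refl ℂ ℂ) fun g => ?_)
  refine LinearMap.ext fun (z : ℂ) => ?_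
  change ((χ g.2 : ℂˣ) : ℂ) • ((SmoothIrrep.ofChar ξ hξ).ρ g.1 z) = (SmoothIrrep.ofChar Ξ hΞ).ρ g z
  rw [SmoothIrrep.ofChar_ρ_apply, SmoothIrrep.ofChar_ρ_apply, hΞξχ, Units.val_mul]
  change ((χ g.2 : ℂˣ) : ℂ) * (((ξ g.1 : ℂˣ) : ℂ) * z) = ((ξ g.1 : ℂˣ) : ℂ) * ((χ g.2 : ℂˣ) : ℂ) * z
  ring

end IrrClass

end Literature.NumberTheory.Automorphic

end
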